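import Literature.MathematicalPhysics.QuantumFieldTheory.Balaban1983to89.B5G183Alias

/-!
# `Balaban1983to89.B5G183AliasSum` — the `n`-UNIFORM ALIAS SUMS of the continued (1.83) entry symbol of `G = Δ₁⁻¹`: the double sum of its REGULAR PART and the Schur row/column bounds of the full fiber matrix on the zero-free strip (cell node X9, successor of `B5G183Strip` / `B5G183Alias`)

T. Bałaban, *Propagators and renormalization transformations for lattice gauge theories. I*, Commun. Math.
Phys. **95**, 17–40 (1984) [`Balaban1984PropagatorsI`, cell paper B5], (1.83)–(1.84) p. 31 [PDF 15], the text
after (1.87)/(1.88) p. 32–33 [PDF 16–17] («… we can easily prove that this expression defines a bounded operator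
on L²(T_η)» — quoted in full, with Proposition 1.1 (1.89) p. 33, in the tree module `B5Prop11Bound`), and p. 38
[PDF 22] (the «analyticity method» pointer to the proof of Lemma 2.4 of [`Balaban1983RegularityDecay`]).  These are
LOCATIONS only: NOTHING printed in B5 is a hypothesis, a quotation or a `[cite:]`-tagged statement of this file;
every declaration is `[folklore]` algebra/estimates about the tree's own objects (`B5G183Strip.g183` and its parts),
kernel-checked from the imported tree modules.  No `axiom`, no `sorry`.

## What the predecessor modules give and what was missing

`B5G183Strip` (this lineage) types the regrouped holomorphic continuation `g183 n μ ν l l′ p′` of the `((l,μ),(l′,ν))`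
entry of the fiber matrix of (1.83) (`U = 1`, `a = 1`, `η = 1/n`, alias offsets `l ∈ (Fin n)^d`), proves that all
its denominators are zero-free on `Strip d κ`, `0 ≤ κ ≤ κ₁₈₃(d)` (`denominators_ne_zero`), its holomorphy there and
the PER-ENTRY bound `‖g183(l,l′;p′)‖ ≤ M183 d` uniform in `n, l, l′` (`norm_g183_le`); `B5G183Alias` proves the
side covariance `g(l,l′; p′ + 2πe_i) = g(σ_i l, σ_i l′; p′)`.  As recorded in `B5G183Alias` (HONEST SCOPE (ii),
v1.1) the DOUBLE alias sum `Σ_{l,l′}‖g183(l,l′;p′)‖` is NOT bounded uniformly in `n`: the diagonal carries the free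
fine-lattice terms `δ_{μν}δ_{ll′}/Δ(p′+l)`, `l ≠ 0`, whose sum `Σ_{l≠0} 1/|Δ(p′+l)|` is of order `n^{d−2}`
(`log n` at `d = 2`).  This file proves that this is the ONLY obstruction.

## What is certified here (kernel; 0 sorry; std axioms)

With `D_n(l) := Π_ν (12/ω_n(l_ν))·ω_n(l_ν)^{−2/d}` and `E_n(l;μ) := ω_n(l_μ)^{−2}Π_{ν≠μ}(12/ω_n(l_ν))·ω_n(l_ν)^{−2/d}`
(`Dw`, `Ew`; the summands of `B5Hk163Alias.sum_prod_decay_le` / `sum_mixed_decay_le`, whose alias sums are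
`≤ (24ζ_d)^d`, `≤ 2ζ₂(24ζ_d)^{d−1}` UNIFORMLY IN `n`), on the zero-free strip `p′ ∈ Strip d κ`, `0 ≤ κ ≤ κ₁₈₃(d)`,
for every `n ≥ 1` (`[NeZero n]`) and all `μ, ν`:

* §3 `diagReg` — the regular part of the `δ_{μν}`-term, `A^{reg}(l,l′;μ) := diagG(l,l′;μ) − δ_{ll′}[l≠0]/Δ(p′+l)`
  (`= R^G_μ/Y^G_μ` at `l = l′ = 0`, `= −ū(p′+l)v̄_μ(p′+l)·u(p′+l′)v_μ(p′+l′)·P(l,l′)/Y^G_μ` otherwise: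
  `diagReg_zero`, `diagReg_of_ne`); `norm_diagReg_le`: **`‖A^{reg}(l,l′;μ)‖ ≤ C_DR(d)·D_n(l)·D_n(l′)`** for ALL
  `l, l′` (product decay in both alias indices: each leaf `ū`, `u` gives `Π_ν 12/ω`, each shifted denominator its
  gain `‖Δ(p′+l)‖ ≥ (7/64)W_n(l) ≥` spread as `Π_ν ω^{−2/d}` — `norm_pairD_le_wt`, `norm_uCbar_wt_le`,
  `norm_uC_wt_le`); `sum_norm_diagReg_le`: `Σ_{l,l′}‖A^{reg}‖ ≤ C_DR(d)·((24ζ_d)^d)²`.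
* §4 `norm_B1_le_decay` / `norm_B2_le_decay`: for `l ≠ 0`, **`‖B1(l,μ)‖ ≤ 4C_Ba(d)·E_n(l;μ) + C_Bb(d)·D_n(l)`**
  (the `∂_μū·Δ/(Δ(p′+l)²𝒩)` piece: no leaf decay in the coordinate `μ` but the double gain `W_n(l)^{−2}`, split
  unevenly by `B5Hk163Alias.inv_W_sq_le`; the `ūv̄_μ∂_{1,μ}/(Y^G_μΔ(p′+l))` piece: full leaf decay and one gain),
  and the conjugate-leaf mirror for `B2(l′,ν)`; `sum_norm_B1_le` / `sum_norm_B2_le`: **`Σ_l‖B1(l,μ)‖ ≤ SB183 d`**,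
  **`Σ_{l′}‖B2(l′,ν)‖ ≤ SB183 d`** (the `l = 0` term by the tree's `norm_B1_le`/`norm_B2_le`).
* §5 `g183reg := g183 − freeDiag`, `freeDiag(l,l′) := δ_{μν}δ_{ll′}[l≠0]/Δ(p′+l)`; `g183reg_eq`:
  `g^{reg} = δ_{μν}A^{reg} + midG·B1(l,μ)·B2(l′,ν)`; **`sum_norm_g183reg_le`:
  `Σ_{l,l′} ‖g^{reg}_{μν}(l,l′;p′)‖ ≤ Mreg183 d`** — the double alias sum of the regular part is bounded by a
  function of `d` ALONE (`Mreg183 d = C_DR·((24ζ_d)^d)² + M_mid·SB183²`, explicit, crude); and, free diagonal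
  INCLUDED (it is one term `≤ 1/2` per row and per column, `row_sum_norm_freeDiag_le` / `col_…`), the SCHUR BOUNDS
  **`row_sum_norm_g183_le`: `Σ_{l′} ‖g_{μν}(l,l′;p′)‖ ≤ 1/2 + Mreg183 d`** for every row `(l,μ)` and every `ν`, and
  **`col_sum_norm_g183_le`** likewise for every column — uniformly in `n`, in `p′` on the (complex) strip, in the
  row/column index.  Summed over the `d` values of `ν` (resp. `μ`) these are the two Schur-test inputs for an
  `n`-uniform `ℓ²(alias × coord) → ℓ²` operator bound `d·(1/2 + Mreg183 d)` of the continued fiber matrices — the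
  strip version of the per-fiber content of Proposition 1.1 (1.89), `‖GJ‖ ≤ γ₀⁻¹‖J‖`, whose REAL-fiber operator
  bound is the tree's `B5Prop11Bound.Fiber.opNorm_G_le` / `B5Prop11Fiber` (a different, abstract-fiber route; not
  imported, not re-proved, not compared here).

## Dictionary (paper ↦ tree ↦ here)

`Δ(p′+l) ↦ DeltaXi n 0 (shift n k p)`; `u, v_μ, ∂_μ` and conjugates `↦ uC/uCbar, vC/vCbar, dC/dCbar`
(`B5Symbol166`); `ω_n(j) = min(j+1, n−j)`, `W_n(l) = Σ_{l_ν≠0} ω_n(l_ν)²`, `ζ_d = Σ_i i^{−(1+2/d)}` (`B4StripSums`);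
the regrouped parts `diagG`, `pairD`, `B1`, `B2`, `midG`, `RG`, `YG`, `Ncal`, the constants `M183`, `MB183`, `Mmid183`,
`kappa183` (`B5G183Strip`), `cY163`, `cN163`, `Bc` (`B5Hk163Strip`, `B5Symbol166Strip`).  New here: `Dw`, `Ew`, `wt`,
`diagReg`, `freeDiag`, `g183reg`, the constants `CDR`, `CBa`, `CBb`, `SB183`, `Mreg183`.

## HONEST SCOPE

(i) THE REGULAR PART IS NOT SIDE-COVARIANT.  The residue re-indexing `σ_i : l ↦ l + e_i` of `B5G183Alias.g183_tr`
moves the special index `l = 0`; the set `{l ≠ 0}` over which `freeDiag` lives is not `σ_i`-invariant, so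
`g^{reg}(l,l′; p′+2πe_i) ≠ g^{reg}(σ_i l, σ_i l′; p′)` in general (they differ by the two free terms exchanged between
`freeDiag` and `diagReg` at `l = l′ ∈ {0, −e_i}`).  Consequently `sum_norm_g183reg_le` is NOT by itself the sup-bound
of a `B4ContourShift.StripRegular` fine-offset multiplier `Σ_{l,l′} e^{i(p′+l)ηa} g^{reg}(l,l′;p′) e^{−i(p′+l′)ηb}`:
that object is holomorphic and `n`-uniformly bounded on the strip but fails the side condition.  A COVARIANT split
with an `n`-uniform regular part must subtract a function of `p′+l` for ALL `l` that is regular at `p′+l = 0` and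
agrees with `1/Δ(p′+l)` to order `W_n(l)^{−d}` at large `l` — e.g. the resolvent expansion
`Σ_{j<N} (Δ(p′+l)+1)^{−(j+1)} = 1/Δ − 1/(Δ(Δ+1)^N)`, `N ≥ d−1`, of the massive fine-lattice propagator (remainder
diagonal `Σ_{l≠0} (64/7)^{N+1}W_n(l)^{−(N+1)} ≤ (64/7)^{N+1}(2ζ₂)^d`-type, uniform in `n`; needs `Re Δ(p′) > −1` on
the strip for the `l = 0` term).  THIS IS NOT DONE HERE (design note for the successor; no statement of this file
depends on it).  What IS covariance-free and `n`-uniform here: the Schur row/column bounds of the FULL `g183`.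
(ii) No `StripRegular` instance, no kernel, no decay and no `ℓ²` operator norm is typed here (the Schur test
itself — `‖A‖_{2→2}² ≤ (max row sum)(max column sum)` — is Mathlib-level bookkeeping left to the consumer that fixes
the index type `alias × coord`).  (iii) CONSTANTS are crude towers of the lineage's strip constants (`Bc(d)`,
`(24ζ_d)^d`, `64/7`, `cY163/cN163/cF163`); only their independence of `n`, `p′`, `l`, `l′` is the content.
(iv) `U = 1`, `a = 1`, `n ≥ 1` arbitrary, dimension `d ≥ 1` wherever a coordinate index occurs, as in the whole
b05/pv15 lineage.  (v) Float cross-check (cell archive `b2b-balaban-pv15-g10/num3/check183sum.py|.out`, direct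
transcription of the regrouped formulas): at a side point of the strip, `d = 3`, `n = 2,…,6`, `μ = ν = 0`: the
regular double sum `3.54, 5.27, 5.86, 6.05, 6.12` (saturating) while the free diagonal sum `0.31, 0.57, 0.83, 1.08,
1.34` grows like `0.25·n = O(n^{d−2})`; near `p′ = 0`: regular sum `1.0009 … 1.0005`, free sum `0.30 … 1.29`; `d = 2`,
`n = 2,…,16`: free sum `0.20 … 0.55` (logarithmic), regular sum `3.73 … 5.89` (saturating); max row sums `≤ 2.91`
throughout.  Value = kernel certificate (the `n`-uniform alias-sum input for the (1.83) layer of cell GAPS row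
G-ne2p2-9 (β), X9; and the strip form of the «bounded operator» sentence of p. 32), NOT summit progress.  Unit
`b2b-balaban-pv15-g10` (PV15 cell lineage, generation 10; author of `B5G183Strip`, `B5G183Alias`).
-/

open scoped BigOperators ComplexConjugate Real
open Finset Complex

namespace Literature.MathematicalPhysics.QuantumFieldTheory.Balaban1983to89.B5G183AliasSum

open Literature.MathematicalPhysics.QuantumFieldTheory.Balaban1983to89.B4Strip
open Literature.MathematicalPhysics.QuantumFieldTheory.Balaban1983to89.B4StripCauchy
open Literature.MathematicalPhysics.QuantumFieldTheory.Balaban1983to89.B5Symbol166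
open Literature.MathematicalPhysics.QuantumFieldTheory.Balaban1983to89.B5Strip145
open Literature.MathematicalPhysics.QuantumFieldTheory.Balaban1983to89.B5Strip145Analytic
open Literature.MathematicalPhysics.QuantumFieldTheory.Balaban1983to89.B5Symbol166Strip hiding Afac
open Literature.MathematicalPhysics.QuantumFieldTheory.Balaban1983to89.B5Hk163Strip hiding Afac
open Literature.MathematicalPhysics.QuantumFieldTheory.Balaban1983to89.B5Hk163Alias
open Literature.MathematicalPhysics.QuantumFieldTheory.Balaban1983to89.B5G183Strip
open Literature.MathematicalPhysics.QuantumFieldTheory.Balaban1983to89.B4StripSums (W omega zetaC one_le_W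
  omega_sq_le_W omega_pos omega_zero one_le_omega inv_W_le_prod_rpow W_nonneg re_DeltaXi_shift_ge_W zetaC_nonneg)

variable {d : ℕ}

/-! ## §1. Norm helpers and the two alias-decay weights -/

section Weights

/-- norm of a product from bounds on the factors. [folklore] -/
private theorem nmul_le {a b : ℂ} {A B : ℝ} (ha : ‖a‖ ≤ A) (hb : ‖b‖ ≤ B) : ‖a * b‖ ≤ A * B := by
  rw [norm_mul]; exact mul_le_mul ha hb (norm_nonneg _) ((norm_nonneg _).trans ha)

/-- norm of a difference from bounds on the terms. [folklore] -/
private theorem nsub_le {a b : ℂ} {A B : ℝ} (ha : ‖a‖ ≤ A) (hb : ‖b‖ ≤ B) : ‖a - b‖ ≤ A + B :=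
  (norm_sub_le a b).trans (add_le_add ha hb)

/-- norm of a sum from bounds on the terms. [folklore] -/
private theorem nadd_le {a b : ℂ} {A B : ℝ} (ha : ‖a‖ ≤ A) (hb : ‖b‖ ≤ B) : ‖a + b‖ ≤ A + B :=
  (norm_add_le a b).trans (add_le_add ha hb)

variable (n : ℕ) [NeZero n]

/-- the PRODUCT decay weight `D_n(l) = Π_ν (12/ω_n(l_ν))·ω_n(l_ν)^{−2/d}` (the summand of
`B5Hk163Alias.sum_prod_decay_le`). [folklore] -/
noncomputable def Dw (k : Fin d → Fin n) : ℝ := ∏ ν, (12 / omega n (k ν) * omega n (k ν) ^ (-(2 : ℝ) / d))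

/-- the MIXED decay weight `E_n(l;μ) = ω_n(l_μ)^{−2}·Π_{ν≠μ} (12/ω_n(l_ν))·ω_n(l_ν)^{−2/d}` (the summand of
`B5Hk163Alias.sum_mixed_decay_le`). [folklore] -/
noncomputable def Ew (μ : Fin d) (k : Fin d → Fin n) : ℝ :=
  (omega n (k μ) ^ 2)⁻¹ * ∏ ν ∈ univ.erase μ, (12 / omega n (k ν) * omega n (k ν) ^ (-(2 : ℝ) / d))

/-- the alias weight of a shifted denominator: `1` at `l = 0`, `1/W_n(l)` else. [folklore] -/
noncomputable def wt (k : Fin d → Fin n) : ℝ := if k = fun _ => 0 then 1 else 1 / W n k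

omit [NeZero n] in
/-- each coordinate factor of the weights is `≥ 0`. [folklore] -/
theorem decay_factor_nonneg (k : Fin d → Fin n) (ν : Fin d) :
    0 ≤ 12 / omega n (k ν) * omega n (k ν) ^ (-(2 : ℝ) / d) :=
  mul_nonneg (div_nonneg (by norm_num) (omega_pos n _ (k ν).isLt).le) (Real.rpow_nonneg (omega_pos n _ (k ν).isLt).le _)

omit [NeZero n] in
/-- `0 ≤ D_n(l)`. [folklore] -/
theorem Dw_nonneg (k : Fin d → Fin n) : 0 ≤ Dw n k :=
  Finset.prod_nonneg (fun ν _ => decay_factor_nonneg n k ν)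

omit [NeZero n] in
/-- `0 ≤ E_n(l;μ)`. [folklore] -/
theorem Ew_nonneg (μ : Fin d) (k : Fin d → Fin n) : 0 ≤ Ew n μ k :=
  mul_nonneg (inv_nonneg.mpr (sq_nonneg _)) (Finset.prod_nonneg (fun ν _ => decay_factor_nonneg n k ν))

/-- `0 ≤ wt`. [folklore] -/
theorem wt_nonneg (k : Fin d → Fin n) : 0 ≤ wt n k := by
  unfold wt; split_ifs
  · exact zero_le_one
  · exact div_nonneg zero_le_one (W_nonneg n k)

/-- `wt(0) = 1`. [folklore] -/
theorem wt_zero : wt n (fun _ : Fin d => (0 : Fin n)) = (1 : ℝ) := by unfold wt; exact if_pos rfl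

/-- `wt(l) = 1/W_n(l)` for `l ≠ 0`. [folklore] -/
theorem wt_of_ne (k : Fin d → Fin n) (hk : k ≠ fun _ => 0) : wt n k = 1 / W n k := by unfold wt; rw [if_neg hk]

/-- `wt ≤ 1`. [folklore] -/
theorem wt_le_one (k : Fin d → Fin n) : wt n k ≤ 1 := by
  unfold wt; split_ifs with hk
  · exact le_rfl
  · rw [div_le_one (lt_of_lt_of_le one_pos (one_le_W n k hk))]; exact one_le_W n k hk

/-- `D_n(0) = 12^d`. [folklore] -/
theorem Dw_zero : Dw n (fun _ : Fin d => (0 : Fin n)) = (12 : ℝ) ^ d := by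
  have hn : 1 ≤ n := Nat.one_le_iff_ne_zero.mpr (NeZero.ne n)
  unfold Dw
  have h1 : omega n ((0 : Fin n) : ℕ) = 1 := by rw [Fin.val_zero]; exact omega_zero n hn
  simp only [h1, div_one, Real.one_rpow, mul_one, Finset.prod_const, Finset.card_univ, Fintype.card_fin]

/-- `1 ≤ D_n(0)`. [folklore] -/
theorem one_le_Dw_zero : 1 ≤ Dw n (fun _ : Fin d => (0 : Fin n)) := by
  rw [Dw_zero]; exact one_le_pow₀ (by norm_num)

omit [NeZero n] in
/-- `Σ_l D_n(l) ≤ (24 ζ_d)^d`, uniformly in `n` (`B5Hk163Alias.sum_prod_decay_le`). [folklore] -/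
theorem sum_Dw_le (hd : 0 < d) : ∑ k : Fin d → Fin n, Dw n k ≤ (24 * zetaC d) ^ d :=
  sum_prod_decay_le n hd

omit [NeZero n] in
/-- `Σ_l E_n(l;μ) ≤ 2ζ_2 (24 ζ_d)^{d−1}`, uniformly in `n` (`B5Hk163Alias.sum_mixed_decay_le`). [folklore] -/
theorem sum_Ew_le (hd : 0 < d) (μ : Fin d) :
    ∑ k : Fin d → Fin n, Ew n μ k ≤ 2 * zetaC 2 * (24 * zetaC d) ^ (d - 1) :=
  sum_mixed_decay_le n hd μ

omit [NeZero n] in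
/-- `0 ≤ Σ_l D_n(l)`. [folklore] -/
theorem sum_Dw_nonneg : 0 ≤ ∑ k : Fin d → Fin n, Dw n k := Finset.sum_nonneg (fun k _ => Dw_nonneg n k)

end Weights

/-! ## §2. The alias-decay dictionary of the leaves, in weight form -/

section Leaves

variable (n : ℕ) [NeZero n]

/-- `‖ūC(p′+l)‖·wt(l) ≤ D_n(l)` for EVERY `l` on the fat region (at `l = 0` both sides are `≤ 12^d = D_n(0)`-trivial;
for `l ≠ 0` the whole quadratic gain `1/W_n(l) ≤ Π_ν ω^{−2/d}` is spread over the coordinates). [folklore] -/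
theorem norm_uCbar_wt_le {r : ℝ} (hr : r ≤ 1 / 4) {q : Fin d → ℂ} (hq : q ∈ Fat d r) (k : Fin d → Fin n) :
    ‖uCbar n k q‖ * wt n k ≤ Dw n k := by
  have hu := norm_uCbar_le_prod n hr hq k
  by_cases hk : k = fun _ => 0
  · subst hk
    have hn : 1 ≤ n := Nat.one_le_iff_ne_zero.mpr (NeZero.ne n)
    have h1 : omega n 0 = 1 := omega_zero n hn
    rw [wt_zero, mul_one, Dw_zero]
    calc ‖uCbar n (fun _ => (0 : Fin n)) q‖ ≤ ∏ _ν : Fin d, 12 / omega n ((0 : Fin n) : ℕ) := hu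
      _ = 12 ^ d := by simp [h1]
  · have hd : 0 < d := by
      by_contra h0
      have hd0 : d = 0 := by omega
      subst hd0
      exact hk (funext (fun ν => Fin.elim0 ν))
    rw [wt_of_ne n k hk]
    have hW := inv_W_le_prod_rpow n hd k hk
    calc ‖uCbar n k q‖ * (1 / W n k)
        ≤ (∏ ν, 12 / omega n (k ν)) * ∏ ν, omega n (k ν) ^ (-(2 : ℝ) / d) :=
          mul_le_mul hu hW (div_nonneg zero_le_one (W_nonneg n k))
            (Finset.prod_nonneg (fun ν _ => div_nonneg (by norm_num) (omega_pos n _ (k ν).isLt).le))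
      _ = Dw n k := by unfold Dw; rw [Finset.prod_mul_distrib]

/-- the conjugate leaf: `‖uC(p′+l)‖·wt(l) ≤ D_n(l)` for every `l`. [folklore] -/
theorem norm_uC_wt_le {r : ℝ} (hr : r ≤ 1 / 4) {q : Fin d → ℂ} (hq : q ∈ Fat d r) (k : Fin d → Fin n) :
    ‖uC n k q‖ * wt n k ≤ Dw n k := by
  rw [uC_eq_conj, Complex.norm_conj]; exact norm_uCbar_wt_le n hr (conjVec_mem_fat hq) k

/-- `‖v̄C_μ(p′+l)‖ ≤ 12` (the first-power decay `12/ω` with `ω ≥ 1` dropped). [folklore] -/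
theorem norm_vCbar_le_twelve {r : ℝ} (hr : r ≤ 1 / 4) {q : Fin d → ℂ} (hq : q ∈ Fat d r)
    (k : Fin d → Fin n) (μ : Fin d) : ‖vCbar n k q μ‖ ≤ 12 := by
  have h := norm_vCbar_le_omega n hr hq k μ
  have hω := one_le_omega n (k μ) (k μ).isLt
  have hω0 := omega_pos n (k μ) (k μ).isLt
  calc ‖vCbar n k q μ‖ ≤ 12 / omega n (k μ) := h
    _ ≤ 12 := by rw [div_le_iff₀ hω0]; nlinarith

/-- `‖vC_μ(p′+l)‖ ≤ 12`. [folklore] -/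
theorem norm_vC_le_twelve {r : ℝ} (hr : r ≤ 1 / 4) {q : Fin d → ℂ} (hq : q ∈ Fat d r)
    (k : Fin d → Fin n) (μ : Fin d) : ‖vC n k q μ‖ ≤ 12 := by
  rw [vC_eq_conj, Complex.norm_conj]; exact norm_vCbar_le_twelve n hr (conjVec_mem_fat hq) k μ

/-- `‖∂_μ(p′+l)·ūC(p′+l)‖/W_n(l)² ≤ 4·E_n(l;μ)`, `l ≠ 0` (no decay in the `μ`-coordinate from the leaf; the
quadratic gain split unevenly, `B5Hk163Alias.inv_W_sq_le`). [folklore] -/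
theorem norm_dC_uCbar_div_W_sq_le {r : ℝ} (hr : r ≤ 1 / 4) {q : Fin d → ℂ} (hq : q ∈ Fat d r)
    (k : Fin d → Fin n) (hk : k ≠ fun _ => 0) (μ : Fin d) :
    ‖dC n k q μ * uCbar n k q‖ * (1 / W n k ^ 2) ≤ 4 * Ew n μ k := by
  have h1 := norm_dC_mul_uCbar_le_prod n hr hq k μ
  have h2 := inv_W_sq_le n k hk μ
  have hP0 : 0 ≤ ∏ ν ∈ univ.erase μ, 12 / omega n (k ν) :=
    Finset.prod_nonneg (fun ν _ => div_nonneg (by norm_num) (omega_pos n _ (k ν).isLt).le)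
  calc ‖dC n k q μ * uCbar n k q‖ * (1 / W n k ^ 2)
      ≤ (4 * ∏ ν ∈ univ.erase μ, 12 / omega n (k ν))
          * ((omega n (k μ) ^ 2)⁻¹ * ∏ ν ∈ univ.erase μ, omega n (k ν) ^ (-(2 : ℝ) / d)) :=
        mul_le_mul h1 h2 (by positivity) (by positivity)
    _ = 4 * Ew n μ k := by unfold Ew; rw [Finset.prod_mul_distrib]; ring

/-- the conjugate mirror: `‖conj ∂_μ(p′+l)·uC(p′+l)‖/W_n(l)² ≤ 4·E_n(l;μ)`, `l ≠ 0`. [folklore] -/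
theorem norm_dCbar_uC_div_W_sq_le {r : ℝ} (hr : r ≤ 1 / 4) {q : Fin d → ℂ} (hq : q ∈ Fat d r)
    (k : Fin d → Fin n) (hk : k ≠ fun _ => 0) (μ : Fin d) :
    ‖dCbar n k q μ * uC n k q‖ * (1 / W n k ^ 2) ≤ 4 * Ew n μ k := by
  rw [dCbar_eq_conj, uC_eq_conj, ← map_mul, Complex.norm_conj]
  exact norm_dC_uCbar_div_W_sq_le n hr (conjVec_mem_fat hq) k hk μ

/-- the `W`-lower bound of a shifted denominator on the fat region: `(7/64)·W_n(l) ≤ ‖Δ(p′+l)‖`, `l ≠ 0`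
(`B4StripSums.re_DeltaXi_shift_ge_W`). [folklore] -/
theorem W_le_norm_DeltaXi_shift {r : ℝ} (hr : r ≤ 1 / 4) (hdr : (d : ℝ) * r ^ 2 ≤ 1 / 16) {q : Fin d → ℂ}
    (hq : q ∈ Fat d r) (k : Fin d → Fin n) (hk : k ≠ fun _ => 0) :
    7 / 64 * W n k ≤ ‖DeltaXi n 0 (shift n k q)‖ :=
  (re_DeltaXi_shift_ge_W n 0 le_rfl hr hdr hq k hk).trans (Complex.re_le_norm _)

end Leaves

/-! ## §3. The REGULAR diagonal part: `diagG` minus the free fine-lattice diagonal `δ_{ll′}/Δ(p′+l)`, `l ≠ 0` -/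

section Diagonal

variable (n : ℕ) [NeZero n]

/-- the regular part of the `δ_{μν}`-term: `A^{reg}(l,l′;μ) := diagG(l,l′;μ) − δ_{ll′}·[l ≠ 0]/Δ(p′+l)`; by the
case analysis of `B5G183Strip.diagG` it equals `R^G_μ/Y^G_μ` at `l = l′ = 0` and
`−ū(p′+l)v̄_μ(p′+l)·u(p′+l′)v_μ(p′+l′)·P(l,l′)/Y^G_μ` otherwise (`diagReg_zero`, `diagReg_of_ne`). [folklore] -/
noncomputable def diagReg (μ : Fin d) (k k' : Fin d → Fin n) (p : Fin d → ℂ) : ℂ :=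
  diagG n μ k k' p - (if k = k' ∧ k ≠ (fun _ => 0) then 1 / DeltaXi n 0 (shift n k p) else 0)

/-- at `l = l′ = 0`: `A^{reg} = R^G_μ/Y^G_μ`. [folklore] -/
theorem diagReg_zero (μ : Fin d) (p : Fin d → ℂ) :
    diagReg n μ (fun _ => 0) (fun _ => 0) p = RG n μ p / YG n μ p := by
  unfold diagReg diagG
  rw [if_pos ⟨rfl, rfl⟩, if_neg (fun h => h.2 rfl), sub_zero]

/-- away from `l = l′ = 0`: `A^{reg}(l,l′;μ) = −ū(p′+l)v̄_μ(p′+l)·u(p′+l′)v_μ(p′+l′)·P(l,l′)/Y^G_μ`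
(the free diagonal is exactly what was subtracted). [folklore] -/
theorem diagReg_of_ne (μ : Fin d) {k k' : Fin d → Fin n} (hkk : ¬ (k = (fun _ => 0) ∧ k' = (fun _ => 0)))
    (p : Fin d → ℂ) :
    diagReg n μ k k' p = -(uCbar n k p * vCbar n k p μ * (uC n k' p * vC n k' p μ) * pairD n k k' p / YG n μ p) := by
  unfold diagReg diagG
  rw [if_neg hkk]
  by_cases he : k = k'
  · have hk : k ≠ fun _ => 0 := fun h => hkk ⟨h, he.symm.trans h⟩
    rw [if_pos he, if_pos ⟨he, hk⟩]; ring
  · rw [if_neg he, if_neg (fun h => he h.1)]; ring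

/-- the weight form of the pair factor: `‖P(l,l′)‖ ≤ B_c·(64/7)²·wt(l)·wt(l′)` unless `l = l′ = 0` (each shifted
denominator contributes its `W`-gain `‖Δ(p′+l)‖ ≥ (7/64)W_n(l)`). [folklore] -/
theorem norm_pairD_le_wt {κ : ℝ} (hκ : κ ≤ kappa183 d) {p : Fin d → ℂ} (hp : p ∈ Strip d κ)
    (k k' : Fin d → Fin n) (hkk : ¬ (k = (fun _ => 0) ∧ k' = (fun _ => 0))) :
    ‖pairD n k k' p‖ ≤ Bc d * (64 / 7) ^ 2 * wt n k * wt n k' := by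
  have hr := rOf_le d
  have hdr := d_mul_rOf_sq_le d
  have hq : p ∈ Fat d (rOf d) := strip_subset_fat (rOf_pos d).le (hκ.trans (kappa183_le_rOf d)) hp
  have hB := one_le_Bc d
  have h1 : ‖(1 : ℂ)‖ ≤ 1 := by simp
  have hWΔ : ∀ l : Fin d → Fin n, l ≠ (fun _ => 0) → 7 / 64 * W n l ≤ ‖DeltaXi n 0 (shift n l p)‖ :=
    fun l hl => W_le_norm_DeltaXi_shift n hr hdr hq l hl
  have hWpos : ∀ l : Fin d → Fin n, l ≠ (fun _ => 0) → 0 < 7 / 64 * W n l :=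
    fun l hl => by have := one_le_W n l hl; positivity
  unfold pairD
  by_cases hk : k = fun _ => 0
  · have hk' : k' ≠ fun _ => 0 := fun h => hkk ⟨hk, h⟩
    rw [if_pos hk, hk, wt_zero, wt_of_ne n k' hk', mul_one]
    have hW1 := one_le_W n k' hk'
    calc ‖1 / DeltaXi n 0 (shift n k' p)‖ ≤ 1 / (7 / 64 * W n k') := norm_div_le_of h1 (hWpos k' hk') (hWΔ k' hk')
      _ = (64 / 7) * (1 / W n k') := by field_simp
      _ ≤ Bc d * (64 / 7) ^ 2 * (1 / W n k') := by
          have h0 : 0 ≤ 1 / W n k' := by positivity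
          nlinarith
  · rw [if_neg hk]
    by_cases hk' : k' = fun _ => 0
    · rw [if_pos hk', hk', wt_zero, wt_of_ne n k hk, mul_one]
      have hW1 := one_le_W n k hk
      calc ‖1 / DeltaXi n 0 (shift n k p)‖ ≤ 1 / (7 / 64 * W n k) := norm_div_le_of h1 (hWpos k hk) (hWΔ k hk)
        _ = (64 / 7) * (1 / W n k) := by field_simp
        _ ≤ Bc d * (64 / 7) ^ 2 * (1 / W n k) := by
            have h0 : 0 ≤ 1 / W n k := by positivity
            nlinarith
    · rw [if_neg hk', wt_of_ne n k hk, wt_of_ne n k' hk']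
      have hW1 := one_le_W n k hk
      have hW1' := one_le_W n k' hk'
      have hprod : (7 / 64 * W n k) * (7 / 64 * W n k') ≤ ‖DeltaXi n 0 (shift n k p) * DeltaXi n 0 (shift n k' p)‖ := by
        rw [norm_mul]
        exact mul_le_mul (hWΔ k hk) (hWΔ k' hk') (hWpos k' hk').le (norm_nonneg _)
      calc ‖DeltaXi n 0 p / (DeltaXi n 0 (shift n k p) * DeltaXi n 0 (shift n k' p))‖
          ≤ Bc d / ((7 / 64 * W n k) * (7 / 64 * W n k')) :=
            norm_div_le_of (norm_DeltaXi0_le_Bc n hr hq) (mul_pos (hWpos k hk) (hWpos k' hk')) hprod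
        _ = Bc d * (64 / 7) ^ 2 * (1 / W n k) * (1 / W n k') := by field_simp

/-- the explicit constant of the regular diagonal part (depends on `d` only). [folklore] -/
noncomputable def CDR (d : ℕ) : ℝ := 2 * Bc d / cY163 d + 144 * Bc d * (64 / 7) ^ 2 / cY163 d

/-- both summands of `CDR` are `≥ 0`. [folklore] -/
theorem CDR_parts_nonneg (d : ℕ) : 0 ≤ 2 * Bc d / cY163 d ∧ 0 ≤ 144 * Bc d * (64 / 7) ^ 2 / cY163 d := by
  have hB := (Bc_pos d).le
  have hc : 0 ≤ cY163 d := by unfold cY163; positivity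
  exact ⟨div_nonneg (by linarith) hc, div_nonneg (by positivity) hc⟩

/-- `0 ≤ CDR d`. [folklore] -/
theorem CDR_nonneg (d : ℕ) : 0 ≤ CDR d := by
  obtain ⟨h1, h2⟩ := CDR_parts_nonneg d; unfold CDR; linarith

/-- **THE DECAYING BOUND OF THE REGULAR DIAGONAL PART**: `‖A^{reg}(l,l′;μ)‖ ≤ C_DR(d)·D_n(l)·D_n(l′)` for ALL
`l, l′` on the zero-free strip (product decay in both alias indices). [folklore] -/
theorem norm_diagReg_le {κ : ℝ} (hκ0 : 0 ≤ κ) (hκ : κ ≤ kappa183 d) {p : Fin d → ℂ} (hp : p ∈ Strip d κ)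
    (μ : Fin d) (k k' : Fin d → Fin n) : ‖diagReg n μ k k' p‖ ≤ CDR d * Dw n k * Dw n k' := by
  have hr := rOf_le d
  have hdr := d_mul_rOf_sq_le d
  have hq : p ∈ Fat d (rOf d) := strip_subset_fat (rOf_pos d).le (hκ.trans (kappa183_le_rOf d)) hp
  obtain ⟨-, -, hY, -⟩ := denominators_lower n hκ0 hκ hp
  have hcY : 0 < cY163 d := by unfold cY163; positivity
  have hYμ : cY163 d ≤ ‖YG n μ p‖ := hY μ
  obtain ⟨hC1, hC2⟩ := CDR_parts_nonneg d
  have hDD : 0 ≤ Dw n k * Dw n k' := mul_nonneg (Dw_nonneg n k) (Dw_nonneg n k')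
  by_cases hkk : k = (fun _ => 0) ∧ k' = (fun _ => 0)
  · obtain ⟨hk, hk'⟩ := hkk
    subst hk; subst hk'
    rw [diagReg_zero]
    have t1 : ‖RG n μ p / YG n μ p‖ ≤ 2 * Bc d / cY163 d := norm_div_le_of (norm_RG_le n hr hdr hq μ) hcY hYμ
    have h1 : 1 ≤ Dw n (fun _ : Fin d => (0 : Fin n)) * Dw n (fun _ : Fin d => (0 : Fin n)) :=
      one_le_mul_of_one_le_of_one_le (one_le_Dw_zero n) (one_le_Dw_zero n)
    calc ‖RG n μ p / YG n μ p‖ ≤ 2 * Bc d / cY163 d := t1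
      _ ≤ CDR d * 1 := by unfold CDR; linarith
      _ ≤ CDR d * (Dw n (fun _ : Fin d => (0 : Fin n)) * Dw n (fun _ : Fin d => (0 : Fin n))) :=
          mul_le_mul_of_nonneg_left h1 (CDR_nonneg d)
      _ = _ := by ring
  · rw [diagReg_of_ne n μ hkk, norm_neg]
    have hu := norm_uCbar_wt_le n hr hq k
    have hu' := norm_uC_wt_le n hr hq k'
    have hv := norm_vCbar_le_twelve n hr hq k μ
    have hv' := norm_vC_le_twelve n hr hq k' μ
    have hP := norm_pairD_le_wt n hκ hp k k' hkk
    have hnum : ‖uCbar n k p * vCbar n k p μ * (uC n k' p * vC n k' p μ) * pairD n k k' p‖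
        ≤ ‖uCbar n k p‖ * 12 * (‖uC n k' p‖ * 12) * (Bc d * (64 / 7) ^ 2 * wt n k * wt n k') :=
      nmul_le (nmul_le (nmul_le le_rfl hv) (nmul_le le_rfl hv')) hP
    have hfrac := norm_div_le_of hnum hcY hYμ
    have hre : ‖uCbar n k p‖ * 12 * (‖uC n k' p‖ * 12) * (Bc d * (64 / 7) ^ 2 * wt n k * wt n k') / cY163 d
        = 144 * Bc d * (64 / 7) ^ 2 / cY163 d * ((‖uCbar n k p‖ * wt n k) * (‖uC n k' p‖ * wt n k')) := by
      field_simp; ring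
    have hww : (‖uCbar n k p‖ * wt n k) * (‖uC n k' p‖ * wt n k') ≤ Dw n k * Dw n k' :=
      mul_le_mul hu hu' (mul_nonneg (norm_nonneg _) (wt_nonneg n k')) (Dw_nonneg n k)
    calc _ ≤ _ := hfrac
      _ = _ := hre
      _ ≤ 144 * Bc d * (64 / 7) ^ 2 / cY163 d * (Dw n k * Dw n k') := mul_le_mul_of_nonneg_left hww hC2
      _ ≤ CDR d * (Dw n k * Dw n k') := by
          apply mul_le_mul_of_nonneg_right _ hDD; unfold CDR; linarith
      _ = CDR d * Dw n k * Dw n k' := by ring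

/-- **THE `n`-UNIFORM DOUBLE ALIAS SUM OF THE REGULAR DIAGONAL PART**:
`Σ_{l,l′} ‖A^{reg}(l,l′;μ)‖ ≤ C_DR(d)·((24ζ_d)^d)²`. [folklore] -/
theorem sum_norm_diagReg_le {κ : ℝ} (hκ0 : 0 ≤ κ) (hκ : κ ≤ kappa183 d) {p : Fin d → ℂ} (hp : p ∈ Strip d κ)
    (μ : Fin d) :
    ∑ k : Fin d → Fin n, ∑ k' : Fin d → Fin n, ‖diagReg n μ k k' p‖ ≤ CDR d * ((24 * zetaC d) ^ d) ^ 2 := by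
  have hd : 0 < d := Fin.pos μ
  have hS := sum_Dw_le n hd
  have hS0 := sum_Dw_nonneg n (d := d)
  calc ∑ k : Fin d → Fin n, ∑ k' : Fin d → Fin n, ‖diagReg n μ k k' p‖
      ≤ ∑ k : Fin d → Fin n, ∑ k' : Fin d → Fin n, CDR d * Dw n k * Dw n k' :=
        Finset.sum_le_sum (fun k _ => Finset.sum_le_sum (fun k' _ => norm_diagReg_le n hκ0 hκ hp μ k k'))
    _ = CDR d * ((∑ k : Fin d → Fin n, Dw n k) * ∑ k' : Fin d → Fin n, Dw n k') := by
        rw [Finset.sum_mul_sum, Finset.mul_sum]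
        refine Finset.sum_congr rfl (fun k _ => ?_)
        rw [Finset.mul_sum]
        refine Finset.sum_congr rfl (fun k' _ => ?_)
        ring
    _ ≤ CDR d * ((24 * zetaC d) ^ d * (24 * zetaC d) ^ d) :=
        mul_le_mul_of_nonneg_left (mul_le_mul hS hS hS0 (hS0.trans hS)) (CDR_nonneg d)
    _ = CDR d * ((24 * zetaC d) ^ d) ^ 2 := by ring

end Diagonal

/-! ## §4. The alias sums of the two brackets `B1(l,μ)`, `B2(l′,ν)` -/

section Brackets

variable (n : ℕ) [NeZero n]

/-- the constant of the `∂ū/Δ²𝒩`-part of the brackets. [folklore] -/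
noncomputable def CBa (d : ℕ) : ℝ := Bc d * (64 / 7) ^ 2 / cN163 d

/-- the constant of the `ūv̄∂₁/(Y^GΔ)`-part of the brackets. [folklore] -/
noncomputable def CBb (d : ℕ) : ℝ := 48 * (64 / 7) / cY163 d

/-- `0 ≤ CBa d`, `0 ≤ CBb d`. [folklore] -/
theorem CB_nonneg (d : ℕ) : 0 ≤ CBa d ∧ 0 ≤ CBb d := by
  have hB := (Bc_pos d).le
  have hcY : 0 ≤ cY163 d := by unfold cY163; positivity
  have hcN : 0 ≤ cN163 d := by unfold cN163; positivity
  exact ⟨div_nonneg (by positivity) hcN, div_nonneg (by positivity) hcY⟩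

/-- **DECAYING BOUND OF THE FIRST BRACKET**, `l ≠ 0`:
`‖B1(l,μ)‖ ≤ 4·C_Ba(d)·E_n(l;μ) + C_Bb(d)·D_n(l)` (the `∂_μ ū Δ/(Δ(p′+l)²𝒩)` piece has no leaf decay in the
coordinate `μ` but the double gain `W_n(l)^{−2}`; the `ūv̄_μ∂_{1,μ}/(Y^G_μΔ(p′+l))` piece has full leaf decay and
one gain). [folklore] -/
theorem norm_B1_le_decay {κ : ℝ} (hκ0 : 0 ≤ κ) (hκ : κ ≤ kappa183 d) {p : Fin d → ℂ} (hp : p ∈ Strip d κ)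
    (μ : Fin d) (k : Fin d → Fin n) (hk : k ≠ fun _ => 0) :
    ‖B1 n μ k p‖ ≤ 4 * CBa d * Ew n μ k + CBb d * Dw n k := by
  have hr := rOf_le d
  have hdr := d_mul_rOf_sq_le d
  have hq : p ∈ Fat d (rOf d) := strip_subset_fat (rOf_pos d).le (hκ.trans (kappa183_le_rOf d)) hp
  obtain ⟨-, hN, hY, -⟩ := denominators_lower n hκ0 hκ hp
  have hκ1 : κ ≤ 1 := (hκ.trans (kappa183_le_rOf d)).trans ((rOf_le d).trans (by norm_num))
  have hcY : 0 < cY163 d := by unfold cY163; positivity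
  have hcN : 0 < cN163 d := by unfold cN163; positivity
  have hYμ : cY163 d ≤ ‖YG n μ p‖ := hY μ
  have hNl : cN163 d ≤ ‖Ncal n p‖ := hN
  have hE := (norm_expFac_le_four hκ1 hp μ).2
  have hΔ := norm_DeltaXi0_le_Bc n hr hq
  have hWΔ := W_le_norm_DeltaXi_shift n hr hdr hq k hk
  have hW1 := one_le_W n k hk
  have hWpos : 0 < 7 / 64 * W n k := by positivity
  obtain ⟨hCa, hCb⟩ := CB_nonneg d
  have heq : B1 n μ k p
      = dC n k p μ * uCbar n k p * (DeltaXi n 0 p / (DeltaXi n 0 (shift n k p) ^ 2 * Ncal n p))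
        - uCbar n k p * vCbar n k p μ * expFacPos μ p / (YG n μ p * DeltaXi n 0 (shift n k p)) := by
    unfold B1; rw [if_neg hk]; ring
  rw [heq]
  have hden1 : (7 / 64 * W n k) ^ 2 * cN163 d ≤ ‖DeltaXi n 0 (shift n k p) ^ 2 * Ncal n p‖ := by
    rw [norm_mul, norm_pow]
    exact mul_le_mul (pow_le_pow_left₀ hWpos.le hWΔ 2) hNl hcN.le (by positivity)
  have hden2 : cY163 d * (7 / 64 * W n k) ≤ ‖YG n μ p * DeltaXi n 0 (shift n k p)‖ := by
    rw [norm_mul]; exact mul_le_mul hYμ hWΔ hWpos.le (norm_nonneg _)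
  have t1 : ‖dC n k p μ * uCbar n k p * (DeltaXi n 0 p / (DeltaXi n 0 (shift n k p) ^ 2 * Ncal n p))‖
      ≤ ‖dC n k p μ * uCbar n k p‖ * (Bc d / ((7 / 64 * W n k) ^ 2 * cN163 d)) :=
    nmul_le le_rfl (norm_div_le_of hΔ (by positivity) hden1)
  have t2 : ‖uCbar n k p * vCbar n k p μ * expFacPos μ p / (YG n μ p * DeltaXi n 0 (shift n k p))‖
      ≤ ‖uCbar n k p‖ * 12 * 4 / (cY163 d * (7 / 64 * W n k)) :=
    norm_div_le_of (nmul_le (nmul_le le_rfl (norm_vCbar_le_twelve n hr hq k μ)) hE) (by positivity) hden2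
  have r1 : ‖dC n k p μ * uCbar n k p‖ * (Bc d / ((7 / 64 * W n k) ^ 2 * cN163 d))
      = CBa d * (‖dC n k p μ * uCbar n k p‖ * (1 / W n k ^ 2)) := by
    unfold CBa; field_simp
  have r2 : ‖uCbar n k p‖ * 12 * 4 / (cY163 d * (7 / 64 * W n k)) = CBb d * (‖uCbar n k p‖ * wt n k) := by
    rw [wt_of_ne n k hk]; unfold CBb; field_simp; ring
  have b1 : CBa d * (‖dC n k p μ * uCbar n k p‖ * (1 / W n k ^ 2)) ≤ CBa d * (4 * Ew n μ k) :=
    mul_le_mul_of_nonneg_left (norm_dC_uCbar_div_W_sq_le n hr hq k hk μ) hCa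
  have b2 : CBb d * (‖uCbar n k p‖ * wt n k) ≤ CBb d * Dw n k :=
    mul_le_mul_of_nonneg_left (norm_uCbar_wt_le n hr hq k) hCb
  calc _ ≤ _ := nsub_le t1 t2
    _ = CBa d * (‖dC n k p μ * uCbar n k p‖ * (1 / W n k ^ 2)) + CBb d * (‖uCbar n k p‖ * wt n k) := by
        rw [r1, r2]
    _ ≤ CBa d * (4 * Ew n μ k) + CBb d * Dw n k := add_le_add b1 b2
    _ = 4 * CBa d * Ew n μ k + CBb d * Dw n k := by ring

/-- **DECAYING BOUND OF THE SECOND BRACKET**, `l′ ≠ 0` (conjugate-leaf mirror of `norm_B1_le_decay`). [folklore] -/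
theorem norm_B2_le_decay {κ : ℝ} (hκ0 : 0 ≤ κ) (hκ : κ ≤ kappa183 d) {p : Fin d → ℂ} (hp : p ∈ Strip d κ)
    (ν : Fin d) (k' : Fin d → Fin n) (hk : k' ≠ fun _ => 0) :
    ‖B2 n ν k' p‖ ≤ 4 * CBa d * Ew n ν k' + CBb d * Dw n k' := by
  have hr := rOf_le d
  have hdr := d_mul_rOf_sq_le d
  have hq : p ∈ Fat d (rOf d) := strip_subset_fat (rOf_pos d).le (hκ.trans (kappa183_le_rOf d)) hp
  obtain ⟨-, hN, hY, -⟩ := denominators_lower n hκ0 hκ hp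
  have hκ1 : κ ≤ 1 := (hκ.trans (kappa183_le_rOf d)).trans ((rOf_le d).trans (by norm_num))
  have hcY : 0 < cY163 d := by unfold cY163; positivity
  have hcN : 0 < cN163 d := by unfold cN163; positivity
  have hYν : cY163 d ≤ ‖YG n ν p‖ := hY ν
  have hNl : cN163 d ≤ ‖Ncal n p‖ := hN
  have hE := (norm_expFac_le_four hκ1 hp ν).1
  have hΔ := norm_DeltaXi0_le_Bc n hr hq
  have hWΔ := W_le_norm_DeltaXi_shift n hr hdr hq k' hk
  have hW1 := one_le_W n k' hk
  have hWpos : 0 < 7 / 64 * W n k' := by positivity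
  obtain ⟨hCa, hCb⟩ := CB_nonneg d
  have heq : B2 n ν k' p
      = dCbar n k' p ν * uC n k' p * (DeltaXi n 0 p / (DeltaXi n 0 (shift n k' p) ^ 2 * Ncal n p))
        - uC n k' p * vC n k' p ν * expFacNeg ν p / (YG n ν p * DeltaXi n 0 (shift n k' p)) := by
    unfold B2; rw [if_neg hk]; ring
  rw [heq]
  have hden1 : (7 / 64 * W n k') ^ 2 * cN163 d ≤ ‖DeltaXi n 0 (shift n k' p) ^ 2 * Ncal n p‖ := by
    rw [norm_mul, norm_pow]
    exact mul_le_mul (pow_le_pow_left₀ hWpos.le hWΔ 2) hNl hcN.le (by positivity)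
  have hden2 : cY163 d * (7 / 64 * W n k') ≤ ‖YG n ν p * DeltaXi n 0 (shift n k' p)‖ := by
    rw [norm_mul]; exact mul_le_mul hYν hWΔ hWpos.le (norm_nonneg _)
  have t1 : ‖dCbar n k' p ν * uC n k' p * (DeltaXi n 0 p / (DeltaXi n 0 (shift n k' p) ^ 2 * Ncal n p))‖
      ≤ ‖dCbar n k' p ν * uC n k' p‖ * (Bc d / ((7 / 64 * W n k') ^ 2 * cN163 d)) :=
    nmul_le le_rfl (norm_div_le_of hΔ (by positivity) hden1)
  have t2 : ‖uC n k' p * vC n k' p ν * expFacNeg ν p / (YG n ν p * DeltaXi n 0 (shift n k' p))‖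
      ≤ ‖uC n k' p‖ * 12 * 4 / (cY163 d * (7 / 64 * W n k')) :=
    norm_div_le_of (nmul_le (nmul_le le_rfl (norm_vC_le_twelve n hr hq k' ν)) hE) (by positivity) hden2
  have r1 : ‖dCbar n k' p ν * uC n k' p‖ * (Bc d / ((7 / 64 * W n k') ^ 2 * cN163 d))
      = CBa d * (‖dCbar n k' p ν * uC n k' p‖ * (1 / W n k' ^ 2)) := by
    unfold CBa; field_simp
  have r2 : ‖uC n k' p‖ * 12 * 4 / (cY163 d * (7 / 64 * W n k')) = CBb d * (‖uC n k' p‖ * wt n k') := by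
    rw [wt_of_ne n k' hk]; unfold CBb; field_simp; ring
  have b1 : CBa d * (‖dCbar n k' p ν * uC n k' p‖ * (1 / W n k' ^ 2)) ≤ CBa d * (4 * Ew n ν k') :=
    mul_le_mul_of_nonneg_left (norm_dCbar_uC_div_W_sq_le n hr hq k' hk ν) hCa
  have b2 : CBb d * (‖uC n k' p‖ * wt n k') ≤ CBb d * Dw n k' :=
    mul_le_mul_of_nonneg_left (norm_uC_wt_le n hr hq k') hCb
  calc _ ≤ _ := nsub_le t1 t2
    _ = CBa d * (‖dCbar n k' p ν * uC n k' p‖ * (1 / W n k' ^ 2)) + CBb d * (‖uC n k' p‖ * wt n k') := by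
        rw [r1, r2]
    _ ≤ CBa d * (4 * Ew n ν k') + CBb d * Dw n k' := add_le_add b1 b2
    _ = 4 * CBa d * Ew n ν k' + CBb d * Dw n k' := by ring

/-- the explicit `n`-UNIFORM majorant of the bracket alias sums (depends on `d` only). [folklore] -/
noncomputable def SB183 (d : ℕ) : ℝ :=
  MB183 d + (4 * CBa d * (2 * zetaC 2 * (24 * zetaC d) ^ (d - 1)) + CBb d * (24 * zetaC d) ^ d)

/-- `0 ≤ SB183 d`. [folklore] -/
theorem SB183_nonneg (d : ℕ) : 0 ≤ SB183 d := by
  obtain ⟨hA, hB⟩ := MB183_parts_nonneg d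
  obtain ⟨hCa, hCb⟩ := CB_nonneg d
  have hz2 := zetaC_nonneg 2
  have hzd := zetaC_nonneg d
  have hM : 0 ≤ MB183 d := by unfold MB183; exact add_nonneg hA hB
  unfold SB183; positivity

/-- the common summation step: a family bounded by `MB183` at `l = 0` and by `4C_Ba·E_n + C_Bb·D_n` at `l ≠ 0` has
alias sum `≤ SB183 d`. [folklore] -/
theorem sum_le_SB183 (μ : Fin d) (f : (Fin d → Fin n) → ℝ) (h0 : f (fun _ => 0) ≤ MB183 d)
    (hne : ∀ k, k ≠ (fun _ => 0) → f k ≤ 4 * CBa d * Ew n μ k + CBb d * Dw n k) :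
    ∑ k : Fin d → Fin n, f k ≤ SB183 d := by
  classical
  have hd : 0 < d := Fin.pos μ
  obtain ⟨hCa, hCb⟩ := CB_nonneg d
  set g : (Fin d → Fin n) → ℝ := fun k => 4 * CBa d * Ew n μ k + CBb d * Dw n k with hg
  have hg0 : ∀ k, 0 ≤ g k := fun k =>
    add_nonneg (mul_nonneg (mul_nonneg (by norm_num) hCa) (Ew_nonneg n μ k)) (mul_nonneg hCb (Dw_nonneg n k))
  have hsplit := Finset.add_sum_erase (Finset.univ : Finset (Fin d → Fin n)) f (Finset.mem_univ (fun _ => 0))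
  have herase : ∑ k ∈ Finset.univ.erase (fun _ => (0 : Fin n)), f k ≤ ∑ k : Fin d → Fin n, g k := by
    calc ∑ k ∈ Finset.univ.erase (fun _ => (0 : Fin n)), f k
        ≤ ∑ k ∈ Finset.univ.erase (fun _ => (0 : Fin n)), g k :=
          Finset.sum_le_sum (fun k hk => hne k (Finset.ne_of_mem_erase hk))
      _ ≤ ∑ k : Fin d → Fin n, g k :=
          Finset.sum_le_sum_of_subset_of_nonneg (Finset.erase_subset _ _) (fun k _ _ => hg0 k)
  have hsumg : ∑ k : Fin d → Fin n, g k
      = 4 * CBa d * ∑ k : Fin d → Fin n, Ew n μ k + CBb d * ∑ k : Fin d → Fin n, Dw n k := by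
    rw [hg, Finset.sum_add_distrib, Finset.mul_sum, Finset.mul_sum]
  have hE := sum_Ew_le n hd μ
  have hD := sum_Dw_le n hd
  calc ∑ k : Fin d → Fin n, f k = f (fun _ => 0) + ∑ k ∈ Finset.univ.erase (fun _ => (0 : Fin n)), f k :=
        hsplit.symm
    _ ≤ MB183 d + ∑ k : Fin d → Fin n, g k := add_le_add h0 herase
    _ = MB183 d + (4 * CBa d * ∑ k : Fin d → Fin n, Ew n μ k + CBb d * ∑ k : Fin d → Fin n, Dw n k) := by
        rw [hsumg]
    _ ≤ SB183 d := by
        unfold SB183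
        have h1 : 4 * CBa d * ∑ k : Fin d → Fin n, Ew n μ k ≤ 4 * CBa d * (2 * zetaC 2 * (24 * zetaC d) ^ (d - 1)) :=
          mul_le_mul_of_nonneg_left hE (by positivity)
        have h2 : CBb d * ∑ k : Fin d → Fin n, Dw n k ≤ CBb d * (24 * zetaC d) ^ d :=
          mul_le_mul_of_nonneg_left hD hCb
        linarith

/-- **THE `n`-UNIFORM ALIAS SUM OF THE FIRST BRACKET**: `Σ_l ‖B1(l,μ)‖ ≤ SB183 d` on the zero-free strip. [folklore] -/
theorem sum_norm_B1_le {κ : ℝ} (hκ0 : 0 ≤ κ) (hκ : κ ≤ kappa183 d) {p : Fin d → ℂ} (hp : p ∈ Strip d κ)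
    (μ : Fin d) : ∑ k : Fin d → Fin n, ‖B1 n μ k p‖ ≤ SB183 d :=
  sum_le_SB183 n μ (fun k => ‖B1 n μ k p‖) (norm_B1_le n hκ0 hκ hp μ _)
    (fun k hk => norm_B1_le_decay n hκ0 hκ hp μ k hk)

/-- **THE `n`-UNIFORM ALIAS SUM OF THE SECOND BRACKET**: `Σ_{l′} ‖B2(l′,ν)‖ ≤ SB183 d`. [folklore] -/
theorem sum_norm_B2_le {κ : ℝ} (hκ0 : 0 ≤ κ) (hκ : κ ≤ kappa183 d) {p : Fin d → ℂ} (hp : p ∈ Strip d κ)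
    (ν : Fin d) : ∑ k' : Fin d → Fin n, ‖B2 n ν k' p‖ ≤ SB183 d :=
  sum_le_SB183 n ν (fun k' => ‖B2 n ν k' p‖) (norm_B2_le n hκ0 hκ hp ν _)
    (fun k' hk => norm_B2_le_decay n hκ0 hκ hp ν k' hk)

end Brackets

/-! ## §5. The regular part of the entry symbol, its `n`-uniform double alias sum, and the Schur row/column bounds of `g183` -/

section Assembly

variable (n : ℕ) [NeZero n]

/-- the FREE FINE-LATTICE DIAGONAL of (1.83): `δ_{μν}δ_{ll′}·[l ≠ 0]/Δ(p′+l)` — the only part of the entry symbol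
whose double alias sum is NOT uniform in `n` (`Σ_{l≠0} 1/|Δ(p′+l)| ≍ n^{d−2}`, the coinciding-point size of the
kernel of `Δ⁻¹` on the `η`-lattice); per row / per column it is ONE term of size `≤ 1/2`. [folklore] -/
noncomputable def freeDiag (μ ν : Fin d) (k k' : Fin d → Fin n) (p : Fin d → ℂ) : ℂ :=
  if k = k' then (if μ = ν ∧ k ≠ (fun _ => 0) then 1 / DeltaXi n 0 (shift n k p) else 0) else 0

/-- **THE REGULAR PART** of the continued (1.83) entry symbol: `g^{reg}_{μν}(l,l′;p′) := g_{μν}(l,l′;p′) −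
δ_{μν}δ_{ll′}[l ≠ 0]/Δ(p′+l)`. [folklore] -/
noncomputable def g183reg (μ ν : Fin d) (k k' : Fin d → Fin n) (p : Fin d → ℂ) : ℂ :=
  g183 n μ ν k k' p - freeDiag n μ ν k k' p

/-- `g = freeDiag + g^{reg}` (definition). [folklore] -/
theorem g183_eq_free_add_reg (μ ν : Fin d) (k k' : Fin d → Fin n) (p : Fin d → ℂ) :
    g183 n μ ν k k' p = freeDiag n μ ν k k' p + g183reg n μ ν k k' p := by
  unfold g183reg; ring

/-- the regular part in terms of the regular diagonal part and the brackets: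
`g^{reg} = δ_{μν}·A^{reg}(l,l′;μ) + midG·B1(l,μ)·B2(l′,ν)`. [folklore] -/
theorem g183reg_eq (μ ν : Fin d) (k k' : Fin d → Fin n) (p : Fin d → ℂ) :
    g183reg n μ ν k k' p = (if μ = ν then diagReg n μ k k' p else 0) + midG n p * B1 n μ k p * B2 n ν k' p := by
  unfold g183reg freeDiag g183 diagReg
  by_cases hμν : μ = ν
  · rw [if_pos hμν, if_pos hμν]
    by_cases he : k = k'
    · rw [if_pos he]
      by_cases hk : k = fun _ => 0
      · rw [if_neg (fun h => h.2 hk), if_neg (fun h => h.2 hk)]; ring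
      · rw [if_pos ⟨hμν, hk⟩, if_pos ⟨he, hk⟩]; ring
    · rw [if_neg he, if_neg (fun h => he h.1)]; ring
  · rw [if_neg hμν, if_neg hμν]
    by_cases he : k = k'
    · rw [if_pos he, if_neg (fun h => hμν h.1)]; ring
    · rw [if_neg he]; ring

/-- the explicit `n`-UNIFORM majorant of the double alias sum of the regular part (depends on `d` only). [folklore] -/
noncomputable def Mreg183 (d : ℕ) : ℝ := CDR d * ((24 * zetaC d) ^ d) ^ 2 + Mmid183 d * SB183 d ^ 2

/-- `0 ≤ Mreg183 d`. [folklore] -/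
theorem Mreg183_nonneg (d : ℕ) : 0 ≤ Mreg183 d := by
  have h1 := CDR_nonneg d
  have h2 := Mmid183_nonneg d
  have h3 := SB183_nonneg d
  unfold Mreg183; positivity

/-- pointwise: `‖g^{reg}(l,l′)‖ ≤ C_DR·D_n(l)D_n(l′) + M_mid·‖B1(l)‖·‖B2(l′)‖`. [folklore] -/
theorem norm_g183reg_le {κ : ℝ} (hκ0 : 0 ≤ κ) (hκ : κ ≤ kappa183 d) {p : Fin d → ℂ} (hp : p ∈ Strip d κ)
    (μ ν : Fin d) (k k' : Fin d → Fin n) :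
    ‖g183reg n μ ν k k' p‖ ≤ CDR d * Dw n k * Dw n k' + Mmid183 d * (‖B1 n μ k p‖ * ‖B2 n ν k' p‖) := by
  rw [g183reg_eq]
  have hdiag : ‖(if μ = ν then diagReg n μ k k' p else 0 : ℂ)‖ ≤ CDR d * Dw n k * Dw n k' := by
    split_ifs with h
    · exact norm_diagReg_le n hκ0 hκ hp μ k k'
    · rw [norm_zero]; exact mul_nonneg (mul_nonneg (CDR_nonneg d) (Dw_nonneg n k)) (Dw_nonneg n k')
  have hthird : ‖midG n p * B1 n μ k p * B2 n ν k' p‖ ≤ Mmid183 d * (‖B1 n μ k p‖ * ‖B2 n ν k' p‖) := by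
    rw [mul_assoc]
    exact nmul_le (norm_midG_le n hκ0 hκ hp) (by rw [norm_mul])
  exact nadd_le hdiag hthird

/-- **THE `n`-UNIFORM DOUBLE ALIAS SUM OF THE REGULAR PART** of the continued (1.83) entry symbol:
`Σ_{l,l′} ‖g^{reg}_{μν}(l,l′;p′)‖ ≤ Mreg183 d` for every `n ≥ 1`, all `μ, ν`, every `p′` of the zero-free strip
`Strip d κ`, `0 ≤ κ ≤ κ₁₈₃(d)`. [folklore] -/
theorem sum_norm_g183reg_le {κ : ℝ} (hκ0 : 0 ≤ κ) (hκ : κ ≤ kappa183 d) {p : Fin d → ℂ} (hp : p ∈ Strip d κ)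
    (μ ν : Fin d) :
    ∑ k : Fin d → Fin n, ∑ k' : Fin d → Fin n, ‖g183reg n μ ν k k' p‖ ≤ Mreg183 d := by
  have hd : 0 < d := Fin.pos μ
  have hS := sum_Dw_le n hd
  have hS0 := sum_Dw_nonneg n (d := d)
  have hB1 := sum_norm_B1_le n hκ0 hκ hp μ
  have hB2 := sum_norm_B2_le n hκ0 hκ hp ν
  have hB10 : 0 ≤ ∑ k : Fin d → Fin n, ‖B1 n μ k p‖ := Finset.sum_nonneg (fun _ _ => norm_nonneg _)
  have hB20 : 0 ≤ ∑ k' : Fin d → Fin n, ‖B2 n ν k' p‖ := Finset.sum_nonneg (fun _ _ => norm_nonneg _)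
  calc ∑ k : Fin d → Fin n, ∑ k' : Fin d → Fin n, ‖g183reg n μ ν k k' p‖
      ≤ ∑ k : Fin d → Fin n, ∑ k' : Fin d → Fin n,
          (CDR d * Dw n k * Dw n k' + Mmid183 d * (‖B1 n μ k p‖ * ‖B2 n ν k' p‖)) :=
        Finset.sum_le_sum (fun k _ => Finset.sum_le_sum (fun k' _ => norm_g183reg_le n hκ0 hκ hp μ ν k k'))
    _ = CDR d * ((∑ k : Fin d → Fin n, Dw n k) * ∑ k' : Fin d → Fin n, Dw n k')
        + Mmid183 d * ((∑ k : Fin d → Fin n, ‖B1 n μ k p‖) * ∑ k' : Fin d → Fin n, ‖B2 n ν k' p‖) := by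
        rw [Finset.sum_mul_sum, Finset.sum_mul_sum, Finset.mul_sum, Finset.mul_sum, ← Finset.sum_add_distrib]
        refine Finset.sum_congr rfl (fun k _ => ?_)
        rw [Finset.mul_sum, Finset.mul_sum, ← Finset.sum_add_distrib]
        refine Finset.sum_congr rfl (fun k' _ => ?_)
        ring
    _ ≤ CDR d * ((24 * zetaC d) ^ d * (24 * zetaC d) ^ d) + Mmid183 d * (SB183 d * SB183 d) :=
        add_le_add (mul_le_mul_of_nonneg_left (mul_le_mul hS hS hS0 (hS0.trans hS)) (CDR_nonneg d))
          (mul_le_mul_of_nonneg_left (mul_le_mul hB1 hB2 hB20 (hB10.trans hB1)) (Mmid183_nonneg d))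
    _ = Mreg183 d := by unfold Mreg183; ring

/-- the free diagonal contributes one term `≤ 1/2` to every ROW. [folklore] -/
theorem row_sum_norm_freeDiag_le {κ : ℝ} (hκ0 : 0 ≤ κ) (hκ : κ ≤ kappa183 d) {p : Fin d → ℂ}
    (hp : p ∈ Strip d κ) (μ ν : Fin d) (k : Fin d → Fin n) :
    ∑ k' : Fin d → Fin n, ‖freeDiag n μ ν k k' p‖ ≤ 1 / 2 := by
  classical
  obtain ⟨-, -, -, hD⟩ := denominators_lower n hκ0 hκ hp
  have hterm : ∀ k', ‖freeDiag n μ ν k k' p‖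
      = if k = k' then ‖(if μ = ν ∧ k ≠ (fun _ => 0) then 1 / DeltaXi n 0 (shift n k p) else 0 : ℂ)‖ else 0 := by
    intro k'; unfold freeDiag; split_ifs <;> simp
  rw [Finset.sum_congr rfl (fun k' _ => hterm k'), Finset.sum_ite_eq Finset.univ k, if_pos (Finset.mem_univ k)]
  split_ifs with h
  · exact norm_div_le_of (by simp) two_pos (hD k h.2)
  · rw [norm_zero]; norm_num

/-- the free diagonal contributes one term `≤ 1/2` to every COLUMN. [folklore] -/
theorem col_sum_norm_freeDiag_le {κ : ℝ} (hκ0 : 0 ≤ κ) (hκ : κ ≤ kappa183 d) {p : Fin d → ℂ}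
    (hp : p ∈ Strip d κ) (μ ν : Fin d) (k' : Fin d → Fin n) :
    ∑ k : Fin d → Fin n, ‖freeDiag n μ ν k k' p‖ ≤ 1 / 2 := by
  classical
  obtain ⟨-, -, -, hD⟩ := denominators_lower n hκ0 hκ hp
  have hterm : ∀ k, ‖freeDiag n μ ν k k' p‖
      = if k = k' then ‖(if μ = ν ∧ k' ≠ (fun _ => 0) then 1 / DeltaXi n 0 (shift n k' p) else 0 : ℂ)‖ else 0 := by
    intro k; unfold freeDiag
    by_cases he : k = k'
    · subst he; simp
    · simp [he]
  rw [Finset.sum_congr rfl (fun k _ => hterm k), Finset.sum_ite_eq' Finset.univ k', if_pos (Finset.mem_univ k')]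
  split_ifs with h
  · exact norm_div_le_of (by simp) two_pos (hD k' h.2)
  · rw [norm_zero]; norm_num

/-- **SCHUR ROW BOUND OF THE CONTINUED (1.83) FIBER MATRIX, UNIFORM IN `n`**: for every row index `(l, μ)` and
every `ν`, `Σ_{l′} ‖g_{μν}(l,l′;p′)‖ ≤ 1/2 + Mreg183 d` on the zero-free strip — the free diagonal INCLUDED (it is
one term per row).  With the column bound this is the Schur-test input for an `n`-uniform `ℓ²(alias) → ℓ²(alias)`
operator bound of the fiber matrices at COMPLEX `p′` (the real-fiber operator bound is the tree's
`B5Prop11Bound`/`B5Prop11Fiber`, Proposition 1.1 (1.89)). [folklore] -/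
theorem row_sum_norm_g183_le {κ : ℝ} (hκ0 : 0 ≤ κ) (hκ : κ ≤ kappa183 d) {p : Fin d → ℂ} (hp : p ∈ Strip d κ)
    (μ ν : Fin d) (k : Fin d → Fin n) :
    ∑ k' : Fin d → Fin n, ‖g183 n μ ν k k' p‖ ≤ 1 / 2 + Mreg183 d := by
  have hfree := row_sum_norm_freeDiag_le n hκ0 hκ hp μ ν k
  have hreg := sum_norm_g183reg_le n hκ0 hκ hp μ ν
  have hrow : ∑ k' : Fin d → Fin n, ‖g183reg n μ ν k k' p‖
      ≤ ∑ k : Fin d → Fin n, ∑ k' : Fin d → Fin n, ‖g183reg n μ ν k k' p‖ :=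
    Finset.single_le_sum (f := fun k => ∑ k' : Fin d → Fin n, ‖g183reg n μ ν k k' p‖)
      (fun k _ => Finset.sum_nonneg (fun _ _ => norm_nonneg _)) (Finset.mem_univ k)
  calc ∑ k' : Fin d → Fin n, ‖g183 n μ ν k k' p‖
      ≤ ∑ k' : Fin d → Fin n, (‖freeDiag n μ ν k k' p‖ + ‖g183reg n μ ν k k' p‖) :=
        Finset.sum_le_sum (fun k' _ => by rw [g183_eq_free_add_reg]; exact norm_add_le _ _)
    _ = ∑ k' : Fin d → Fin n, ‖freeDiag n μ ν k k' p‖ + ∑ k' : Fin d → Fin n, ‖g183reg n μ ν k k' p‖ :=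
        Finset.sum_add_distrib
    _ ≤ 1 / 2 + Mreg183 d := add_le_add hfree (hrow.trans hreg)

/-- **SCHUR COLUMN BOUND, UNIFORM IN `n`**: `Σ_l ‖g_{μν}(l,l′;p′)‖ ≤ 1/2 + Mreg183 d` for every column index
`(l′, ν)` and every `μ`. [folklore] -/
theorem col_sum_norm_g183_le {κ : ℝ} (hκ0 : 0 ≤ κ) (hκ : κ ≤ kappa183 d) {p : Fin d → ℂ} (hp : p ∈ Strip d κ)
    (μ ν : Fin d) (k' : Fin d → Fin n) :
    ∑ k : Fin d → Fin n, ‖g183 n μ ν k k' p‖ ≤ 1 / 2 + Mreg183 d := by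
  have hfree := col_sum_norm_freeDiag_le n hκ0 hκ hp μ ν k'
  have hreg := sum_norm_g183reg_le n hκ0 hκ hp μ ν
  have hcol : ∑ k : Fin d → Fin n, ‖g183reg n μ ν k k' p‖
      ≤ ∑ k : Fin d → Fin n, ∑ k'' : Fin d → Fin n, ‖g183reg n μ ν k k'' p‖ :=
    Finset.sum_le_sum (fun k _ => Finset.single_le_sum (f := fun k'' => ‖g183reg n μ ν k k'' p‖)
      (fun _ _ => norm_nonneg _) (Finset.mem_univ k'))
  calc ∑ k : Fin d → Fin n, ‖g183 n μ ν k k' p‖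
      ≤ ∑ k : Fin d → Fin n, (‖freeDiag n μ ν k k' p‖ + ‖g183reg n μ ν k k' p‖) :=
        Finset.sum_le_sum (fun k _ => by rw [g183_eq_free_add_reg]; exact norm_add_le _ _)
    _ = ∑ k : Fin d → Fin n, ‖freeDiag n μ ν k k' p‖ + ∑ k : Fin d → Fin n, ‖g183reg n μ ν k k' p‖ :=
        Finset.sum_add_distrib
    _ ≤ 1 / 2 + Mreg183 d := add_le_add hfree (hcol.trans hreg)

end Assembly

end Literature.MathematicalPhysics.QuantumFieldTheory.Balaban1983to89.B5G183AliasSum
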